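import Summits.ABC.IUTFork.Repair.CandJoshi24Profile
import Summits.ABC.IUTFork.Repair.EvalValUPossible
import HarnessLib

/-!
# IUT REPAIR branch, §A on the VAL(U) family, III — the POSSIBLE-image rows AWAY from the pole `¼ ∈ U` (abc-iut-rp-cx, gen 2)

Sequel to `EvalValUProfile` (p443882: the KUMMER-image rows of §A are FALSE on VAL(U) for every `U`) and `EvalValUPossible`
(p445871: at the pole `¼ ∈ U` the POSSIBLE-image rows RP-L01 / RP-M32 / RP-J01 (b) HOLD together with S), made possible by
abc-iut-rp-j2's hull sequel `CandJoshi24Hull` / `CandJoshi24Profile` (p-ids per STATUS; `u_bridgeHyps`, `u_joshiVolumeDominance_iff`,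
`u_statement_iff`, `u_logvolInvariant_iff`, `u_residual_iff` BY NAME). Three kernel facts, for every scalar group `U` inside the
positive rationals:

1. **RP-M32b ⟺ `¼ ∈ U`**, for every `ρ`, `qK` (`m32b_valU_iff`): packetwise volume-matching of the q-pilot region with SOME possible
   image forces the scalar `¼` into `U` (label `2`: `μ(H_{4u}) = μ(H_1)` iff `u = ¼`). So RP-M32b, like RP-M32a and READING R3, is
   coextensive with S on the whole family.
2. **RP-J01 (b) off the pole** (`jvd_offPole_cells`; `JoshiVolumeDominance` is row RP-J01 (b) of the table — ERRATUM: this seat's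
   earlier files `EvalCoarseProfile`, `EvalShellProfile`, `EvalTightProfile`, `EvalValUPossible` label it «RP-J02» in docstrings): for `¼ ∉ U ≠ ⊥` abc-iut-rp-j1's `JoshiVolumeDominance` HOLDS (rp-j2:
   `JoshiVolumeDominance ⟺ U ≠ ⊥`) while S FAILS and Step (x) log-volume invariance FAILS — RP-J01 (b) is SAT⁺-with-`¬S` exactly on the
   NON-isometric members, i.e. INSUFFICIENT there, and only where print's Step (x) isometry clause is violated (§J split unchanged:
   a possible-image row is TRUE only where a clause of the honest interface is missing).
3. **At the isometric pole `U = ⊥`** (`bot_possibleRows_false`): the honest exact-`j²` Step-(x) member of the family — BridgeHyps,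
   `hAdm`, log-volume invariance, `|log(q)| > 0`, pins, typed Thm. 3.11 all HOLD — and there RP-L01 ✗ (every `ρ`, `qK`), RP-M32b ✗
   (every `ρ`, `qK`), RP-J01 (b) ✗, S ✗, and the typed Corollary inequality itself FAILS (rp-j2 `u_statement_iff`).

4. **RP-L01 ⟺ the affine condition `u₁ + 4·u₂ = 2` is solvable in `U`** (`l01_valU_iff`, every `ρ`, `qK`): solved by `(1, ¼)` at
   the pole, unsolvable at `⊥`, and solvable WITHOUT `¼` — **instance `U = ⟨2/5⟩`** (`twoFifths_cells`): RP-L01 ✓ for every `ρ`,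
   `qK` while S ✗, RP-M32b ✗, Step (x) isometry ✗, Statement ✓. So on the family RP-L01 is STRICTLY WEAKER than RP-M32b, TRUE
   without S only off the isometric pole, and INSUFFICIENT there (a learning for the prover side: the global average-volume reading
   (9-1) does not pin the scalar, the packetwise reading does).
PROOF-ONLY: no `def`, nothing restated. This file takes NO position on [IUTchIII] Corollary 3.12 or on any assessment of it
(Mochizuki; Scholze–Stix; Joshi; Dupuy–Hilado); candidates are hypotheses; typed ≠ endorsed; model data ≠ the intended objects.
-/

open Set

namespace Summit.ABC.IUTFork.Repair.EvalValUPole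

open Cor312 Cor312.Checks Cor312.IdentifiedNonVacuity Cor312Vol Cor312Vol.NaiveWitness Cor312Vol.UnitWitness
  Cor312Vol.PinnedWitness Literature.IUT.LogThetaLattice Summit.ABC.IUTFork.Repair Summit.ABC.IUTFork.Repair.ScalarShells
  Summit.ABC.IUTFork.Repair.ScalarShellsThm311 Summit.ABC.IUTFork.Repair.CandJoshi24
open Thm311 hiding toyIndex

variable (p : ℕ) [hp : Fact p.Prime] {U : Subgroup ℚˣ} (hU : U ≤ Units.posSubgroup ℚ)

/-! ## 0. Honest data of the family in ceiling shape -/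

omit hp in
/-- The (Ind3)-enlarged region is honestly `j²`-scaled, ceiling shape (cx `valU_thetaRegion_logvol`). [folklore] -/
theorem valU_scaled3 (U : Subgroup ℚˣ) (i : Fin toyIndex.lstar) (vQ : toyIndex.VQ) :
    ((uFull p U).toLatticeSituation.D (uSetting p U).n).logvol _ vQ ((uSetting p U).thetaRegion3 (Setting.labelSucc i) vQ) =
      (((i : ℕ) + 1 : ℕ) : ℝ) ^ 2 * (uSetting p U).qLocal (Setting.labelSucc i) vQ := by
  rw [uSetting_thetaRegion3, ← uSetting_thetaRegion p U 0]; exact EvalValUProfile.valU_thetaRegion_logvol p U 0 i vQ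

omit hp in
/-- The q-volume is label-independent (cx `valU_qLocal`). [folklore] -/
theorem valU_indep (U : Subgroup ℚˣ) (i i' : Fin toyIndex.lstar) (vQ : toyIndex.VQ) :
    (uSetting p U).qLocal (Setting.labelSucc i) vQ = (uSetting p U).qLocal (Setting.labelSucc i') vQ := by
  rw [EvalValUProfile.valU_qLocal, EvalValUProfile.valU_qLocal]

include hU

variable (ρ : (∀ v : toyIndex.V, v ∈ toyIndex.Vbad → Set ((uShells p U).StarPacket v)) →
    ∀ (j : toyIndex.Label) (vQ : toyIndex.VQ), Set ((uShells p U).Packet j vQ))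
  (qK : ∀ v : toyIndex.V, v ∈ toyIndex.Vbad → Set ((uShells p U).StarPacket v))

/-! ## 1. RP-M32b ⟺ `¼ ∈ U` -/

/-- **RP-M32b forces the scalar `¼`**: if in every packet of `𝔽_l^⋇` SOME possible image of the Θ-pilot has the q-pilot's volume, then
at label `2` that image is `H_{4u}` with `μ(H_{4u}) = μ(H_1)`, so `u = ¼ ∈ U`. [folklore] -/
theorem quarter_mem_of_m32b (h : CandMochizuki32.H' (uFull p U).toLatticeSituation (uSetting p U) ρ qK) :
    CandJoshi23.quarter ∈ U := by
  obtain ⟨V, hV, hvol⟩ := h ⟨1, by decide⟩ ()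
  obtain ⟨Φ, hΦ, rfl⟩ := hV
  obtain ⟨u, hu, hΦc⟩ := (ScalarShells.actsByScalars_of_mem_closure hΦ).scalar _ ()
  have hu0 : (0 : ℚ) < u := (Units.mem_posSubgroup _).1 (hU hu)
  have h4 : jsq (Setting.labelSucc (T := toyIndex) ⟨1, by decide⟩) = 4 := by decide
  rw [uSetting_thetaRegion3, image_uHalf_of_line_eq p U _ hu0 hΦc, EvalValUProfile.valU_qLocal, h4] at hvol
  change -Real.log p = uVol p U _ () (uHalf p U _ () _) at hvol
  rw [uVol_uHalf] at hvol
  push_cast at hvol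
  have hl := log_p_pos p
  have h1 : ((((u : ℚˣ) : ℚ) : ℝ) * 4 - 1) * Real.log p = 0 := by linarith
  have h2 : (((u : ℚˣ) : ℚ) : ℝ) * 4 = 1 := by
    rcases mul_eq_zero.1 h1 with h | h
    · linarith
    · exact absurd h hl.ne'
  have h3 : ((u : ℚˣ) : ℚ) * 4 = 1 := by exact_mod_cast h2
  have h5 : u = CandJoshi23.quarter := by
    refine Units.ext ?_
    show ((u : ℚˣ) : ℚ) = (4⁻¹ : ℚ)
    exact eq_inv_of_mul_eq_one_left h3
  exact h5 ▸ hu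

/-- **RP-M32b ⟺ `¼ ∈ U` on VAL(U)**, for every `ρ`, `qK` (← : cx `m32_valU_of_quarter`, p445871) — coextensive with S
(rp-j2 `u_residual_iff`). [folklore] -/
theorem m32b_valU_iff : CandMochizuki32.H' (uFull p U).toLatticeSituation (uSetting p U) ρ qK ↔ CandJoshi23.quarter ∈ U :=
  ⟨quarter_mem_of_m32b p hU ρ qK, fun hq => (EvalValUPossible.m32_valU_of_quarter p hU ρ qK hq).2.1⟩

/-- **RP-M32b ⟺ S on VAL(U)** (at the pinned data `uRho`, `uQDatum`). [folklore] -/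
theorem m32b_valU_iff_residual :
    CandMochizuki32.H' (uFull p U).toLatticeSituation (uSetting p U) (uRho p U) (uQDatum p U) ↔
      PilotKummerIndRelated (uFull p U).toLatticeSituation (uSetting p U) (uRho p U) (uQDatum p U) :=
  (m32b_valU_iff p hU (uRho p U) (uQDatum p U)).trans (u_residual_iff p U hU).symm

/-! ## 2. RP-J01 (b) `JoshiVolumeDominance` off the pole: TRUE exactly on the non-isometric members, with `¬S` -/

omit ρ qK in
/-- **RP-J01 (b) OFF THE POLE** (`¼ ∉ U`, `U ≠ ⊥`): `JoshiVolumeDominance` HOLDS (rp-j2 `u_joshiVolumeDominance_iff`), S FAILS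
(`u_residual_iff`), Step (x) log-volume invariance FAILS (`u_logvolInvariant_iff`), and RP-M32b FAILS for every `ρ`, `qK` — RP-J01 (b) is
SAT⁺-with-`¬S` (INSUFFICIENT) precisely where print's isometry clause is violated. [claim: Joshi2021ATSII, status: disputed] -/
theorem jvd_offPole_cells (hq : CandJoshi23.quarter ∉ U) (hne : U ≠ ⊥) :
    CandJoshi1.JoshiVolumeDominance (uSetting p U) ∧
      ¬ PilotKummerIndRelated (uFull p U).toLatticeSituation (uSetting p U) (uRho p U) (uQDatum p U) ∧
      ¬ (uData p U).LogvolInvariant ∧ (uSetting p U).Statement ∧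
      ∀ ρ' qK', ¬ CandMochizuki32.H' (uFull p U).toLatticeSituation (uSetting p U) ρ' qK' :=
  ⟨(u_joshiVolumeDominance_iff p U hU).2 hne, fun h => hq ((u_residual_iff p U hU).1 h),
    fun h => hne ((u_logvolInvariant_iff p U hU).1 h), (u_statement_iff p U hU).2 hne,
    fun ρ' qK' h => hq (quarter_mem_of_m32b p hU ρ' qK' h)⟩

/-! ## 3. The isometric pole `U = ⊥`: an honest exact-`j²` Step-(x) bed — every possible-image row FALSE -/

omit hU ρ qK in
/-- **RP-L01 ✗ at `U = ⊥`**, for every `ρ`, `qK` (cx ceiling `l01_false_of_honestData` fed rp-j2's honest data BY NAME). [folklore] -/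
theorem l01_false_bot
    (ρ : (∀ v : toyIndex.V, v ∈ toyIndex.Vbad → Set ((uShells p (⊥ : Subgroup ℚˣ)).StarPacket v)) →
      ∀ (j : toyIndex.Label) (vQ : toyIndex.VQ), Set ((uShells p (⊥ : Subgroup ℚˣ)).Packet j vQ))
    (qK : ∀ v : toyIndex.V, v ∈ toyIndex.Vbad → Set ((uShells p (⊥ : Subgroup ℚˣ)).StarPacket v)) :
    ¬ CandLana1.H (uFull p ⊥).toLatticeSituation (uSetting p ⊥) ρ qK :=
  EvalHonestCeilingL01.l01_false_of_honestData (uFull p ⊥).toLatticeSituation (uSetting p ⊥) ρ qK (u_bridgeHyps p ⊥ bot_le)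
    (u_hAdm p ⊥ bot_le) ((u_logvolInvariant_iff p ⊥ bot_le).2 rfl) (valU_scaled3 p ⊥) (valU_indep p ⊥) (u_absLogQPos p ⊥)

omit hU ρ qK in
/-- **RP-J01 (b) `JoshiVolumeDominance` ✗ at `U = ⊥`** (rp-j2 `u_joshiVolumeDominance_iff`). [folklore] -/
theorem jvd_false_bot : ¬ CandJoshi1.JoshiVolumeDominance (uSetting p (⊥ : Subgroup ℚˣ)) :=
  fun h => (u_joshiVolumeDominance_iff p ⊥ bot_le).1 h rfl

omit hU ρ qK in
/-- **RP-M32b ✗ at `U = ⊥`**, for every `ρ`, `qK` (`¼ ∉ ⊥`). [folklore] -/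
theorem m32b_false_bot
    (ρ : (∀ v : toyIndex.V, v ∈ toyIndex.Vbad → Set ((uShells p (⊥ : Subgroup ℚˣ)).StarPacket v)) →
      ∀ (j : toyIndex.Label) (vQ : toyIndex.VQ), Set ((uShells p (⊥ : Subgroup ℚˣ)).Packet j vQ))
    (qK : ∀ v : toyIndex.V, v ∈ toyIndex.Vbad → Set ((uShells p (⊥ : Subgroup ℚˣ)).StarPacket v)) :
    ¬ CandMochizuki32.H' (uFull p ⊥).toLatticeSituation (uSetting p ⊥) ρ qK :=
  fun h => CandJoshi24.quarter_ne_one (Subgroup.mem_bot.1 (quarter_mem_of_m32b p bot_le ρ qK h))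

omit hU ρ qK in
/-- **THE ISOMETRIC POLE `U = ⊥` IS AN HONEST BED WITH EVERY POSSIBLE-IMAGE ROW FALSE**: typed Thm. 3.11 ✓, BridgeHyps ✓, Step (x)
(`hAdm` ✓, log-volume invariance ✓), `|log(q)| > 0` ✓, three pins ✓, exact `j²` ✓; RP-L01 ✗ and RP-M32b ✗ for every `ρ`, `qK`,
RP-J01 (b) ✗, S ✗ — and the typed Corollary 3.12 inequality FAILS here (rp-j2 `u_statement_iff`). [folklore] -/
theorem bot_possibleRows_false :
    ((uFull p (⊥ : Subgroup ℚˣ)).Statement ∧ BridgeHyps (uSetting p (⊥ : Subgroup ℚˣ)) ∧ (uData p (⊥ : Subgroup ℚˣ)).LogvolInvariant ∧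
      (uSetting p (⊥ : Subgroup ℚˣ)).AbsLogQPos ∧
      PinnedRegions3 (uFull p ⊥).toLatticeSituation (uSetting p ⊥) (uRho p ⊥) (uQDatum p ⊥)) ∧
    ((∀ ρ qK, ¬ CandLana1.H (uFull p ⊥).toLatticeSituation (uSetting p (⊥ : Subgroup ℚˣ)) ρ qK) ∧
      (∀ ρ qK, ¬ CandMochizuki32.H' (uFull p ⊥).toLatticeSituation (uSetting p (⊥ : Subgroup ℚˣ)) ρ qK) ∧
      ¬ CandJoshi1.JoshiVolumeDominance (uSetting p (⊥ : Subgroup ℚˣ))) ∧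
    ¬ PilotKummerIndRelated (uFull p ⊥).toLatticeSituation (uSetting p (⊥ : Subgroup ℚˣ)) (uRho p ⊥) (uQDatum p ⊥) ∧
    ¬ (uSetting p (⊥ : Subgroup ℚˣ)).Statement :=
  ⟨⟨uFull_statement p ⊥, u_bridgeHyps p ⊥ bot_le, (u_logvolInvariant_iff p ⊥ bot_le).2 rfl, u_absLogQPos p ⊥,
      u_pinnedRegions3 p ⊥ bot_le⟩,
    ⟨l01_false_bot p, m32b_false_bot p, jvd_false_bot p⟩,
    fun h => CandJoshi24.quarter_ne_one (Subgroup.mem_bot.1 ((u_residual_iff p ⊥ bot_le).1 h)),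
    fun h => (u_statement_iff p ⊥ bot_le).1 h rfl⟩


/-! ## 4. RP-L01 on the family: an AFFINE condition on `U` — strictly weaker than S off the pole -/

omit hp hU in
/-- Log-volume of a half-line in the chart (rp-j2 `uVol_uHalf`, ceiling shape). [folklore] -/
theorem valU_logvol_uHalf (U : Subgroup ℚˣ) (j : toyIndex.Label) (vQ : toyIndex.VQ) (a : ℚ) :
    ((uFull p U).toLatticeSituation.D (uSetting p U).n).logvol j vQ (uHalf p U j vQ a) = -(a : ℝ) * Real.log p :=
  uVol_uHalf p U j vQ a

/-- **RP-L01 forces an affine relation in `U`**: a global choice of possible images `H_{u₁·1}`, `H_{u₂·4}` (`u₁, u₂ ∈ U`) with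
procession-normalised volume `−|log(q)| = −log p` means `(u₁ + 4u₂)/2 = 1`. [folklore] -/
theorem exists_affine_of_l01 (h : CandLana1.H (uFull p U).toLatticeSituation (uSetting p U) ρ qK) :
    ∃ u₁ ∈ U, ∃ u₂ ∈ U, (u₁ : ℚ) + 4 * (u₂ : ℚ) = 2 := by
  obtain ⟨W, hW⟩ := h
  obtain ⟨Φ₁, hΦ₁, hW₁⟩ := W.2 (⟨0, by decide⟩, default)
  obtain ⟨u₁, hu₁, hΦ₁c⟩ := (ScalarShells.actsByScalars_of_mem_closure hΦ₁).scalar _ default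
  obtain ⟨Φ₂, hΦ₂, hW₂⟩ := W.2 (⟨1, by decide⟩, default)
  obtain ⟨u₂, hu₂, hΦ₂c⟩ := (ScalarShells.actsByScalars_of_mem_closure hΦ₂).scalar _ default
  have hu₁0 : (0 : ℚ) < u₁ := (Units.mem_posSubgroup _).1 (hU hu₁)
  have hu₂0 : (0 : ℚ) < u₂ := (Units.mem_posSubgroup _).1 (hU hu₂)
  have h1 : jsq (Setting.labelSucc (T := toyIndex) ⟨0, by decide⟩) = 1 := by decide
  have h4 : jsq (Setting.labelSucc (T := toyIndex) ⟨1, by decide⟩) = 4 := by decide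
  rw [uSetting_thetaRegion3, image_uHalf_of_line_eq p U _ hu₁0 hΦ₁c, h1] at hW₁
  rw [uSetting_thetaRegion3, image_uHalf_of_line_eq p U _ hu₂0 hΦ₂c, h4] at hW₂
  refine ⟨u₁, hu₁, u₂, hu₂, ?_⟩
  rw [u_negLogQ] at hW
  have hW' : ((∑ᶠ vQ : toyIndex.VQ, ((uFull p U).toLatticeSituation.D (uSetting p U).n).logvol _ vQ (W.1 (⟨0, by decide⟩, vQ))) +
      (∑ᶠ vQ : toyIndex.VQ, ((uFull p U).toLatticeSituation.D (uSetting p U).n).logvol _ vQ (W.1 (⟨1, by decide⟩, vQ)))) /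
        ((2 : ℕ) : ℝ) = -Real.log p := by
    rw [← hW]
    unfold processionNormalized
    congr 1
    exact (Fin.sum_univ_two fun i : Fin 2 => ∑ᶠ vQ : toyIndex.VQ,
      ((uFull p U).toLatticeSituation.D (uSetting p U).n).logvol _ vQ (W.1 (i, vQ))).symm
  rw [finsum_unique, finsum_unique] at hW'
  change (((uFull p U).toLatticeSituation.D (uSetting p U).n).logvol _ default (W.1 (⟨0, by decide⟩, default)) +
      ((uFull p U).toLatticeSituation.D (uSetting p U).n).logvol _ default (W.1 (⟨1, by decide⟩, default))) / ((2 : ℕ) : ℝ) =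
    -Real.log p at hW'
  rw [hW₁, hW₂, valU_logvol_uHalf, valU_logvol_uHalf] at hW'
  push_cast at hW'
  have hl := log_p_pos p
  have h2 : ((((u₁ : ℚˣ) : ℚ) : ℝ) + 4 * (((u₂ : ℚˣ) : ℚ) : ℝ) - 2) * Real.log p = 0 := by linear_combination (-2 : ℝ) * hW'
  rcases mul_eq_zero.1 h2 with h3 | h3
  · exact_mod_cast (by linarith : (((u₁ : ℚˣ) : ℚ) : ℝ) + 4 * (((u₂ : ℚˣ) : ℚ) : ℝ) = 2)
  · exact absurd h3 hl.ne'

omit hp in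
/-- **… and every such relation realises RP-L01**: move the Θ-image by `u₁` at label `1` and by `u₂` at label `2` ((Ind2)-scalings of
the chart, rp-j2 `uHead`). [folklore] -/
theorem l01_of_affine {u₁ u₂ : ℚˣ} (hu₁ : u₁ ∈ U) (hu₂ : u₂ ∈ U) (h : (u₁ : ℚ) + 4 * (u₂ : ℚ) = 2) :
    CandLana1.H (uFull p U).toLatticeSituation (uSetting p U) ρ qK := by
  have hu₁0 : (0 : ℚ) < u₁ := (Units.mem_posSubgroup _).1 (hU hu₁)
  have hu₂0 : (0 : ℚ) < u₂ := (Units.mem_posSubgroup _).1 (hU hu₂)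
  obtain ⟨w, hw0, hw1, hwU, hw0'⟩ : ∃ w : Fin toyIndex.lstar → ℚˣ, w (0 : Fin 2) = u₁ ∧ w (1 : Fin 2) = u₂ ∧ (∀ i, w i ∈ U) ∧
      ∀ i, (0 : ℚ) < w i :=
    ⟨fun i => if (i : ℕ) = 0 then u₁ else u₂, if_pos (by decide), if_neg (by decide),
      fun i => by dsimp only; split <;> assumption, fun i => by dsimp only; split <;> assumption⟩
  refine ⟨⟨fun t => uHalf p U _ t.2 ((w t.1 : ℚ) * (jsq (Setting.labelSucc t.1) : ℚ)),
    fun t => ⟨uHead p U (fun _ => w t.1), uHead_mem_closure (fun _ => hwU t.1),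
      by rw [uSetting_thetaRegion3, image_uHalf_uHead_const p U (hw0' t.1)]⟩⟩, ?_⟩
  rw [u_negLogQ]
  unfold processionNormalized
  show (∑ i : Fin 2, ∑ᶠ vQ : toyIndex.VQ, ((uFull p U).toLatticeSituation.D (uSetting p U).n).logvol (Setting.labelSucc i) vQ
      (uHalf p U _ vQ ((w i : ℚ) * (jsq (Setting.labelSucc i) : ℚ)))) / ((2 : ℕ) : ℝ) = -Real.log p
  rw [Fin.sum_univ_two, finsum_unique, finsum_unique, valU_logvol_uHalf, valU_logvol_uHalf, hw0, hw1]
  have j0 : jsq (Setting.labelSucc (T := toyIndex) (0 : Fin 2)) = 1 := by decide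
  have j1 : jsq (Setting.labelSucc (T := toyIndex) (1 : Fin 2)) = 4 := by decide
  rw [j0, j1]
  push_cast
  have h' : (((u₁ : ℚˣ) : ℚ) : ℝ) + 4 * (((u₂ : ℚˣ) : ℚ) : ℝ) = 2 := by exact_mod_cast h
  linear_combination (-(Real.log p) / 2) * h'

/-- **RP-L01 on VAL(U) ⟺ the affine condition `u₁ + 4·u₂ = 2` is solvable in `U`** (every `ρ`, `qK`). At the pole it is solved by
`(1, ¼)` (the S-solution); at `U = ⊥` it is not (`5 ≠ 2`); and it has solutions WITHOUT `¼`, e.g. `u₁ = u₂ = 2/5`. [folklore] -/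
theorem l01_valU_iff : CandLana1.H (uFull p U).toLatticeSituation (uSetting p U) ρ qK ↔
    ∃ u₁ ∈ U, ∃ u₂ ∈ U, (u₁ : ℚ) + 4 * (u₂ : ℚ) = 2 :=
  ⟨exists_affine_of_l01 p hU ρ qK, fun ⟨_, hu₁, _, hu₂, h⟩ => l01_of_affine p hU ρ qK hu₁ hu₂ h⟩

/-! ## 5. Instance `U = ⟨2/5⟩`: RP-L01 TRUE WITHOUT S on a non-isometric member — INSUFFICIENT, and strictly weaker than RP-M32b -/

omit hp hU ρ qK in
/-- `⟨2/5⟩` is a nontrivial group of positive scalars NOT containing `¼` (`(2/5)^k = ¼` has no integer solution: parity for `k ≥ 0`,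
divisibility by `5` for `k < 0`). [folklore] -/
theorem twoFifths_facts :
    Subgroup.zpowers (Units.mk0 (2 / 5 : ℚ) (by norm_num)) ≤ Units.posSubgroup ℚ ∧
      Subgroup.zpowers (Units.mk0 (2 / 5 : ℚ) (by norm_num)) ≠ ⊥ ∧
      Units.mk0 (2 / 5 : ℚ) (by norm_num) ∈ Subgroup.zpowers (Units.mk0 (2 / 5 : ℚ) (by norm_num)) ∧
      CandJoshi23.quarter ∉ Subgroup.zpowers (Units.mk0 (2 / 5 : ℚ) (by norm_num)) := by
  refine ⟨Subgroup.zpowers_le.2 ((Units.mem_posSubgroup _).2 (by show (0 : ℚ) < 2 / 5; norm_num)),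
    Subgroup.zpowers_ne_bot.2 (fun h => absurd (congrArg Units.val h) (by show (2 / 5 : ℚ) ≠ 1; norm_num)),
    Subgroup.mem_zpowers _, fun h => ?_⟩
  obtain ⟨k, hk⟩ := Subgroup.mem_zpowers_iff.1 h
  have hk' : ((2 : ℚ) / 5) ^ k = 4⁻¹ := by
    have := congrArg Units.val hk
    rw [Units.val_zpow_eq_zpow_val] at this
    exact this
  obtain ⟨n, rfl | rfl⟩ := Int.eq_nat_or_neg k
  · rw [zpow_natCast, div_pow] at hk'
    have h5 : (0 : ℚ) < 5 ^ n := by positivity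
    have h1 : (4 : ℚ) * 2 ^ n = 5 ^ n := by
      field_simp at hk'
      linarith
    have h2 : (4 : ℕ) * 2 ^ n = 5 ^ n := by exact_mod_cast h1
    have h3 : Even (5 ^ n) := ⟨2 * 2 ^ n, by rw [← h2]; ring⟩
    exact absurd (Nat.even_pow.1 h3).1 (by decide)
  · rw [zpow_neg, zpow_natCast, div_pow] at hk'
    have h5 : (0 : ℚ) < 5 ^ n := by positivity
    have h1 : (2 : ℚ) ^ n = 4 * 5 ^ n := by
      field_simp at hk'
      linarith
    have h2 : (2 : ℕ) ^ n = 4 * 5 ^ n := by exact_mod_cast h1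
    rcases n with _ | m
    · simp at h2
    · have hd : 5 ∣ 2 ^ (m + 1) := ⟨4 * 5 ^ m, by rw [h2]; ring⟩
      have := Nat.le_of_dvd (by norm_num) (Nat.Prime.dvd_of_dvd_pow (by norm_num : Nat.Prime 5) hd)
      omega

omit hU ρ qK in
/-- **Instance `U = ⟨2/5⟩`** (non-isometric, `¼ ∉ U`): RP-L01 HOLDS for every `ρ`, `qK` (`u₁ = u₂ = 2/5`: ONE (Ind2)-scaling moving
both Θ-images) while S FAILS, RP-M32b FAILS for every `ρ`, `qK`, Step (x) log-volume invariance FAILS and the typed Statement HOLDS —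
with typed Thm. 3.11, the three pins, BridgeHyps and `|log(q)| > 0`. RP-L01 is SAT⁺-with-`¬S` here: INSUFFICIENT, strictly weaker
than RP-M32b on the family, and TRUE only off the isometric pole. [folklore] -/
theorem twoFifths_cells :
    (∀ ρ qK, CandLana1.H (uFull p (Subgroup.zpowers (Units.mk0 (2 / 5 : ℚ) (by norm_num)))).toLatticeSituation (uSetting p _) ρ qK) ∧
      ¬ PilotKummerIndRelated (uFull p (Subgroup.zpowers (Units.mk0 (2 / 5 : ℚ) (by norm_num)))).toLatticeSituation (uSetting p _)
        (uRho p _) (uQDatum p _) ∧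
      (∀ ρ qK, ¬ CandMochizuki32.H' (uFull p (Subgroup.zpowers (Units.mk0 (2 / 5 : ℚ) (by norm_num)))).toLatticeSituation
        (uSetting p _) ρ qK) ∧
      ¬ (uData p (Subgroup.zpowers (Units.mk0 (2 / 5 : ℚ) (by norm_num)))).LogvolInvariant ∧
      (uSetting p (Subgroup.zpowers (Units.mk0 (2 / 5 : ℚ) (by norm_num)))).Statement ∧
      (uFull p (Subgroup.zpowers (Units.mk0 (2 / 5 : ℚ) (by norm_num)))).Statement ∧
      PinnedRegions3 (uFull p (Subgroup.zpowers (Units.mk0 (2 / 5 : ℚ) (by norm_num)))).toLatticeSituation (uSetting p _)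
        (uRho p _) (uQDatum p _) ∧
      BridgeHyps (uSetting p (Subgroup.zpowers (Units.mk0 (2 / 5 : ℚ) (by norm_num)))) ∧
      (uSetting p (Subgroup.zpowers (Units.mk0 (2 / 5 : ℚ) (by norm_num)))).AbsLogQPos := by
  obtain ⟨hle, hne, hmem, hq⟩ := twoFifths_facts
  exact ⟨fun ρ qK => l01_of_affine p hle ρ qK hmem hmem (by norm_num), fun h => hq ((u_residual_iff p _ hle).1 h),
    fun ρ qK h => hq (quarter_mem_of_m32b p hle ρ qK h), fun h => hne ((u_logvolInvariant_iff p _ hle).1 h),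
    (u_statement_iff p _ hle).2 hne, uFull_statement p _, u_pinnedRegions3 p _ hle, u_bridgeHyps p _ hle, u_absLogQPos p _⟩

end Summit.ABC.IUTFork.Repair.EvalValUPole
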